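/-
Copyright (c) 2026 the pub-hodgecm-mathlib formalisation cell (harness21).  Prover seat hodgecm-mathlib-A-p14 (g32), P6 «MOD programme»,
F0P6d-plan (g2) DEAL 8 «(S-H-mod)»; 2026-09-01.
-/
import Mathlib.LinearAlgebra.TensorProduct.Quotient
import Mathlib.LinearAlgebra.TensorProduct.Pi
import Mathlib.RingTheory.DedekindDomain.Ideal.Lemmas
import Mathlib.RingTheory.LocalRing.Module
import Mathlib.RingTheory.Spectrum.Prime.FreeLocus
import Mathlib.RingTheory.Flat.Stability
import HarnessLib

/-!
# Torsion quotients of a finite projective module of rank `m` over a Dedekind domain are FREE: `M ∕ xM ≃ (𝒪 ∕ x)^m`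

Topic `RingTheory/DedekindDomain`, namespace `Literature.RingTheory.DedekindDomain.ProjectiveTorsionQuotient`.  THEOREMS ONLY (no definition, no named fact, no
`instance`, no notation, no `sorry`; pure commutative algebra over Mathlib).  Cell `hodgecm-mathlib` (D-0151), F0/P6 «MOD», F0P6d-plan (g2) **DEAL 8 «(S-H-mod)
TORSION QUOTIENTS OF A RANK-`m` PROJECTIVE MODULE ARE FREE»** = the MODULE half of GEN՚s socket (S-H) (with DEAL 7 «fixed points of the block idempotent on
`(𝒪∕pⁿ)^m`» and DEAL 5 «BT transport» the only remaining (S-H) input is the Tate∕Betti comparison `A_Ω[pⁿ](Ω) ≅ H∕pⁿH` for a projective `𝒪_F`-module `H` of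
rank 2); `--supports stmt-HodgeConjecture-24832`, COUNT-NEUTRAL.  HONEST LABEL: HC_CM is proved only modulo the 2 remaining named inputs (hLiu418 24832, h413 24833)
until rung 0 closes; this file discharges none of them.

## Mathematics

`𝒪` a Dedekind domain, `M` a finitely generated projective `𝒪`-module of rank `m` (`Module.finrank 𝒪 M = m`, the generic rank), `x ∈ 𝒪 ∖ {0}`.  Then
**`M ∕ xM ≅ (𝒪 ∕ x𝒪)^m`** as `𝒪`-modules.  Proof (no structure theorem for projective modules over Dedekind domains is used): `M∕IM ≅ (𝒪∕I) ⊗_𝒪 M`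
(Mathlib `TensorProduct.quotTensorEquivQuotSMul`); `𝒪∕(x) ≅ ∏_{𝔭 ∣ x} 𝒪∕𝔭^{v_𝔭(x)}` (Mathlib `IsDedekindDomain.quotientEquivPiFactors`, CRT) and `⊗` commutes with
finite products; each `𝒪∕𝔭^e` (`e ≥ 1`, `𝔭` maximal) is a LOCAL ring (§1), so the finite flat module `(𝒪∕𝔭^e) ⊗ M` is FREE (Mathlib `Module.free_of_flat_of_isLocalRing`),
of rank `m` because the rank of a finite flat module over a domain is constant on `Spec` and computed at the generic point (Mathlib `Module.rankAtStalk_baseChange`,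
`Ideal.finrank_fiber_eq_finrank`) (§2); reassembling the free pieces gives `(𝒪∕x)^m` (§3).  In particular for `x = pⁿ`: `M∕pⁿM ≅ (𝒪∕pⁿ)^m` — the carrier of DEAL 7.
[Bourbaki1989CommAlg] II §5 no. 3 Prop. 5 (projective of constant rank over a semilocal ring is free); [Neukirch1999] Ch. I §3 (CRT in Dedekind domains).

## Contents

* §1 `isLocalRing_quotient_pow_of_isMaximal` (`𝒪∕𝔭^e` is local, any commutative ring, `𝔭` maximal, `e ≠ 0`), `nontrivial_quotient_pow_of_isMaximal`.
* §2 `finrank_baseChange_eq_finrank` (rank of the free base change of a finite flat module over a domain to a nontrivial algebra = generic rank),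
  **`nonempty_baseChange_linearEquiv_pi`** (`(S ⊗ M) ≃ₗ[S] (Fin m → S)` for a LOCAL nontrivial `𝒪`-algebra `S`).
* §3 **`nonempty_quotient_linearEquiv_pi_of_isDedekindDomain`** (the HEAD: `(M ⧸ (x)•⊤) ≃ₗ[𝒪] (Fin m → 𝒪 ⧸ (x))`), **`nonempty_quotient_pow_linearEquiv_pi`**
  (`x := p^n`, DEAL 7՚s carrier `Fin m → 𝒪 ⧸ Ideal.span {(p:𝒪)^n}` token-exact).

## References
* [Bourbaki1989CommAlg] N. Bourbaki, *Commutative Algebra*, Ch. II §5 no. 3, Prop. 5 (p. 112) (constant rank over a semilocal ring ⇒ free).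
* [Neukirch1999] J. Neukirch, *Algebraic Number Theory* (1999), Ch. I §3 (Thm. 3.6, Chinese remainder theorem in a Dedekind domain).
* [StacksProject] The Stacks Project, Tag 00NX (finite flat over local is free), Tag 02M9.
-/

set_option autoImplicit false

open TensorProduct Module

namespace Literature.RingTheory.DedekindDomain.ProjectiveTorsionQuotient

universe u v

/-! ## §1 `𝒪 ∕ 𝔭^e` is a local ring -/

section Local

variable {O : Type u} [CommRing O]

/-- **`𝒪 ∕ 𝔭^e` is LOCAL** for a maximal ideal `𝔭` and `e ≠ 0`: its unique maximal ideal is `𝔭 ∕ 𝔭^e` (any maximal ideal of the quotient pulls back to a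
maximal ideal containing `𝔭^e`, hence to `𝔭`). [cite: Neukirch1999, Ch. I §3] -/
theorem isLocalRing_quotient_pow_of_isMaximal (P : Ideal O) [hP : P.IsMaximal] {e : ℕ} (he : e ≠ 0) : IsLocalRing (O ⧸ P ^ e) := by
  have hsurj : Function.Surjective (Ideal.Quotient.mk (P ^ e)) := Ideal.Quotient.mk_surjective
  -- every maximal ideal of the quotient is the image of `P`
  have hkey : ∀ K : Ideal (O ⧸ P ^ e), K.IsMaximal → K = P.map (Ideal.Quotient.mk (P ^ e)) := by
    intro K hK
    haveI := hK
    have hc : (K.comap (Ideal.Quotient.mk (P ^ e))).IsMaximal := Ideal.comap_isMaximal_of_surjective _ hsurj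
    have hle : P ^ e ≤ K.comap (Ideal.Quotient.mk (P ^ e)) := by
      intro a ha
      rw [Ideal.mem_comap, Ideal.Quotient.eq_zero_iff_mem.2 ha]
      exact K.zero_mem
    have hPK : P ≤ K.comap (Ideal.Quotient.mk (P ^ e)) := (Ideal.IsPrime.pow_le_iff he).1 hle
    have hEq : K.comap (Ideal.Quotient.mk (P ^ e)) = P := (hP.eq_of_le hc.ne_top hPK).symm
    exact (Ideal.map_comap_of_surjective _ hsurj K).symm.trans (congrArg _ hEq)
  -- `P ∕ P^e` is proper: its pull-back is `P ⊔ P^e = P`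
  have hcomap : (P.map (Ideal.Quotient.mk (P ^ e))).comap (Ideal.Quotient.mk (P ^ e)) = P := by
    rw [Ideal.comap_map_of_surjective _ hsurj, ← RingHom.ker_eq_comap_bot, Ideal.mk_ker]
    exact sup_eq_left.2 (Ideal.pow_le_self he)
  have hne : P.map (Ideal.Quotient.mk (P ^ e)) ≠ ⊤ := fun h =>
    hP.ne_top (by rw [← hcomap, h, Ideal.comap_top])
  obtain ⟨K, hK, hPK⟩ := Ideal.exists_le_maximal _ hne
  have hKeq := hkey K hK
  refine IsLocalRing.of_unique_max_ideal ⟨K, hK, fun K' hK' => ?_⟩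
  rw [hkey K' hK', hKeq]

/-- `𝒪 ∕ 𝔭^e` is nontrivial for a proper `𝔭` and `e ≠ 0`. [cite: Neukirch1999, Ch. I §3] -/
theorem nontrivial_quotient_pow_of_ne_top (P : Ideal O) (hP : P ≠ ⊤) {e : ℕ} (he : e ≠ 0) : Nontrivial (O ⧸ P ^ e) := by
  refine Ideal.Quotient.nontrivial_iff.2 (fun h => hP ?_)
  have h' : P ^ e ≤ P := Ideal.pow_le_self he
  rw [h] at h'
  exact top_le_iff.1 h'

end Local

/-! ## §2 The free base change of a finite flat module over a domain has the generic rank -/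

section Rank

variable {O : Type u} [CommRing O] [IsDomain O] {M : Type v} [AddCommGroup M] [Module O M] [Module.Finite O M] [Module.Flat O M]
  (S : Type u) [CommRing S] [Algebra O S]

/-- **The rank of the free base change `S ⊗ M` equals the generic rank `finrank 𝒪 M`** (`𝒪` a domain, `M` finite flat, `S` a nontrivial `𝒪`-algebra with
`S ⊗ M` free): the rank function of `M` on `Spec 𝒪` is constant (Mathlib `Ideal.finrank_fiber_eq_finrank`) and base-changes (Mathlib `Module.rankAtStalk_baseChange`).
[cite: StacksProject, Tag 02M9] -/
theorem finrank_baseChange_eq_finrank [Nontrivial S] [Module.Free S (S ⊗[O] M)] : Module.finrank S (S ⊗[O] M) = Module.finrank O M := by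
  obtain ⟨𝔮⟩ := (inferInstance : Nonempty (PrimeSpectrum S))
  have h1 := congrFun (Module.rankAtStalk_eq_finrank_of_free (R := S) (M := S ⊗[O] M)) 𝔮
  rw [Module.rankAtStalk_baseChange, Module.rankAtStalk_eq] at h1
  simp only [Pi.natCast_apply, Nat.cast_id] at h1
  rw [← h1]
  exact Ideal.finrank_fiber_eq_finrank (M := M) _

/-- **Over a LOCAL nontrivial `𝒪`-algebra `S`, `S ⊗ M ≃ₗ[S] S^m`** for a finite projective `M` of generic rank `m` (`S ⊗ M` is finite flat over the local `S`,
hence free — Mathlib `Module.free_of_flat_of_isLocalRing` — of rank `m` by `finrank_baseChange_eq_finrank`). [cite: StacksProject, Tag 00NX] [cite: Bourbaki1989CommAlg, Ch. II §5 no. 3 Prop. 5] -/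
theorem nonempty_baseChange_linearEquiv_pi [IsLocalRing S] {m : ℕ} (hm : Module.finrank O M = m) :
    Nonempty ((S ⊗[O] M) ≃ₗ[S] (Fin m → S)) := by
  haveI : Module.Free S (S ⊗[O] M) := Module.free_of_flat_of_isLocalRing
  have hr : Module.finrank S (S ⊗[O] M) = m := (finrank_baseChange_eq_finrank (M := M) S).trans hm
  exact ⟨(Module.finBasisOfFinrankEq S (S ⊗[O] M) hr).equivFun⟩

end Rank

/-! ## §3 CRT assembly over a Dedekind domain -/

section Dedekind

variable (O : Type u) [CommRing O] [IsDedekindDomain O] (M : Type v) [AddCommGroup M] [Module O M] [Module.Finite O M] [Module.Projective O M]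

/-- **TORSION QUOTIENTS OF A RANK-`m` PROJECTIVE MODULE ARE FREE**: for a Dedekind domain `𝒪`, a finite projective `𝒪`-module `M` of generic rank `m`
(`Module.finrank 𝒪 M = m`) and `x ≠ 0`, `M ∕ xM ≃ₗ[𝒪] (𝒪 ∕ x)^m`. [cite: Bourbaki1989CommAlg, Ch. II §5 no. 3 Prop. 5] [cite: Neukirch1999, Ch. I §3] -/
theorem nonempty_quotient_linearEquiv_pi_of_isDedekindDomain {m : ℕ} (hm : Module.finrank O M = m) (x : O) (hx : x ≠ 0) :
    Nonempty ((M ⧸ (Ideal.span {x} • (⊤ : Submodule O M))) ≃ₗ[O] (Fin m → O ⧸ Ideal.span {x})) := by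
  classical
  set I : Ideal O := Ideal.span {x} with hIdef
  have hI : I ≠ ⊥ := by rw [hIdef, Ne, Ideal.span_singleton_eq_bot]; exact hx
  -- the CRT decomposition `𝒪 ∕ I ≃ₐ[𝒪] ∏ 𝒪 ∕ 𝔭^{e}`
  let ι : Type u := ↥(UniqueFactorizationMonoid.factors I).toFinset
  let e : ι → ℕ := fun P => Multiset.count (P : Ideal O) (UniqueFactorizationMonoid.factors I)
  let S : ι → Type u := fun P => O ⧸ (P : Ideal O) ^ e P
  let crt : (O ⧸ I) ≃ₐ[O] (∀ P : ι, S P) :=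
    AlgEquiv.ofRingEquiv (f := IsDedekindDomain.quotientEquivPiFactors hI) (fun a => by
      rw [Ideal.Quotient.algebraMap_eq, IsDedekindDomain.quotientEquivPiFactors_mk]
      rfl)
  -- each factor ring is local and nontrivial
  have hmem : ∀ P : ι, (P : Ideal O) ∈ UniqueFactorizationMonoid.factors I := fun P => Multiset.mem_toFinset.1 P.2
  have hprime : ∀ P : ι, (P : Ideal O).IsPrime := fun P => Ideal.isPrime_of_prime (UniqueFactorizationMonoid.prime_of_factor _ (hmem P))
  have hne_bot : ∀ P : ι, (P : Ideal O) ≠ ⊥ := fun P => (UniqueFactorizationMonoid.prime_of_factor _ (hmem P)).ne_zero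
  have hmax : ∀ P : ι, (P : Ideal O).IsMaximal := fun P => (hprime P).isMaximal (hne_bot P)
  have he : ∀ P : ι, e P ≠ 0 := fun P => (Multiset.count_pos.2 (hmem P)).ne'
  haveI : ∀ P : ι, IsLocalRing (S P) := fun P => by
    haveI := hmax P
    exact isLocalRing_quotient_pow_of_isMaximal (P : Ideal O) (he P)
  haveI : ∀ P : ι, Nontrivial (S P) := fun P => nontrivial_quotient_pow_of_ne_top (P : Ideal O) (hmax P).ne_top (he P)
  -- free pieces `(S P) ⊗ M ≃ₗ[S P] (Fin m → S P)`, read `𝒪`-linearly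
  have piece : ∀ P : ι, ((S P) ⊗[O] M) ≃ₗ[O] (Fin m → S P) := fun P =>
    ((nonempty_baseChange_linearEquiv_pi (M := M) (S P) hm).some).restrictScalars O
  -- the swap `(∀ P, Fin m → S P) ≃ₗ[O] (Fin m → ∀ P, S P)`
  let swap : (∀ P : ι, Fin m → S P) ≃ₗ[O] (Fin m → ∀ P : ι, S P) :=
    { toFun := fun f j P => f P j
      invFun := fun g P j => g j P
      map_add' := fun _ _ => rfl
      map_smul' := fun _ _ => rfl
      left_inv := fun _ => rfl
      right_inv := fun _ => rfl }
  refine ⟨(TensorProduct.quotTensorEquivQuotSMul M I).symm ≪≫ₗ TensorProduct.congr crt.toLinearEquiv (LinearEquiv.refl O M) ≪≫ₗ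
    TensorProduct.comm O (∀ P : ι, S P) M ≪≫ₗ TensorProduct.piRight O O M S ≪≫ₗ
    LinearEquiv.piCongrRight (fun P => TensorProduct.comm O M (S P) ≪≫ₗ piece P) ≪≫ₗ swap ≪≫ₗ
    LinearEquiv.piCongrRight (fun _ => crt.symm.toLinearEquiv)⟩

/-- **DEAL 7՚s carrier, token-exact: `M ∕ pⁿM ≃ₗ[𝒪] (Fin m → 𝒪 ∕ Ideal.span {(p:𝒪)^n})`** for a prime (or any) natural `p` with `(p : 𝒪) ≠ 0`.
[cite: Bourbaki1989CommAlg, Ch. II §5 no. 3 Prop. 5] [cite: Neukirch1999, Ch. I §3] -/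
theorem nonempty_quotient_pow_linearEquiv_pi {m : ℕ} (hm : Module.finrank O M = m) (p n : ℕ) (hp : (p : O) ≠ 0) :
    Nonempty ((M ⧸ (Ideal.span {((p : O) ^ n)} • (⊤ : Submodule O M))) ≃ₗ[O] (Fin m → O ⧸ Ideal.span {((p : O) ^ n)})) :=
  nonempty_quotient_linearEquiv_pi_of_isDedekindDomain O M hm _ (pow_ne_zero n hp)

end Dedekind

end Literature.RingTheory.DedekindDomain.ProjectiveTorsionQuotient
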